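import Literature.MathematicalPhysics.QuantumFieldTheory.Balaban1983to89.Node00.LocalGaugePlaquette

/-!
# NODE 00 — print's SECOND-ORDER potential letter `∂^{ξ*}∂^ξA` ([15] Thm 1 (10) p. 279 ∕ [6] (1.140) p. 100) AT THE OBJECTS OF RECORD, and the local-gauge
# clause carrying it: `Sect2.LocalGauge10On Y ξ t U` = def-P11's `Sect2.LocalGaugeOn Y ξ t U` ([15] (9) line 1 in ∃-form) + `‖∂^{ξ*}∂^ξA‖ < t` on the deep bonds of `Y`

Cell `pub-ymgap`, seat `pub-ymgap-dag-n07-e` generation 13 (R141 (C), DAG node N07 = [15]; cell INBOX INTENT-33 of 2026-08-27).  NEW leaf, DEFINITION kind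
(five `def`s with bodies, no named `Prop` fact); node00-def-P11's FILE 14 `Node00.Record12BgRowCoClassGauge` (`Sect2.LocalGaugeOn`, `Sect2.regionOfSet` letters),
this seat's module 31 `Node00.LocalGaugePlaquette` (`ιSU_plaqHol_gaugeAct_SU`), pub-balaban's `Beta.TransportVertices` (`holonomy`) and `B12Membership314`
(`norm_I_mul_smul`) CONSUMED BY NAME, nothing modified.  `--supports stmt-QuantumFields-20541` (K0⁷).  Companions (same INTENT): `Node00.CoDivergenceExpansion`
(the Banach-algebra side of [6] (1.54)) and `Node00.LocalGaugeCoDivergence` (the estimate: these letters ⇒ the (1.9) member of [15]'s class (2)).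
[15] = [Balaban1985Variational]; [6] = [Balaban1985RegularSpaces]; [I] = [Balaban1987RG1]; B9 = [Balaban1985BackgroundPropagators].

WHY.  [15] Thm 1's regularity conclusions for the minimiser are (9) `U^u = e^{iηA}`, `|A| < B₃Mε₁(L^jη)⁻¹`, `|∇^ηA| < B₃Mε₁(L^jη)⁻²` (+ a Hölder member) and (10)
`|∂^{η*}∂^ηA|, |Δ^ηA| < B₃Mε₁(L^jη)⁻³` — sup bounds on the potential, its first differences, and exactly TWO second-order OPERATORS ([6] p. 83: «such information
is unavailable for the second order derivatives»; this seat's LOCATED-M6).  Sect. F's last step (168) p. 304 reads BOTH members of the class (2) = [6] (1.7) ∧ (1.9)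
off these letters via [6]'s basic estimate (1.54) ([6] Sect. G Prop. 7 p. 100: (1.140) `(L^jη)|A|, (L^jη)²|D_{U₀}A|, (L^jη)³|D*_{U₀}D_{U₀}A| < α₂` ⇒ (1.141) plaquettes,
(1.142) co-divergence).  The tree's ∃-gauge clause `Sect2.LocalGaugeOn Y ξ t U` (def-P11 FILE 14; the letter of this seat's (152)∕(9) tokens and of [I] (1.12))
carries `|A|, |∇^ξA|` ONLY — enough for the plaquette member (module 31 `plaqSmallOn_of_localGaugeOn`), NOT for the co-divergence member (1.9), whose linear
part is `iξ³·∂^{ξ*}∂^ξA` (dag-ref-G READ213 NOTE-2 on module 31).  This file TYPES the missing letter at NODE 00's objects, in the tree's units (`U^u = e^{iξA}`,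
differences normalised by `ξ⁻¹` as in r11's `grad`), and the clause `Sect2.LocalGauge10On` = `LocalGaugeOn` + the (10)-letter `‖∂^{ξ*}∂^ξA(b)‖ < t` on the bonds
`b` of `Y` whose nearest-neighbour collar lies in `Y` (`Sect2.bondsDeep Y` — where the operator only reads potential letters inside `Y`).  The Laplacian member
`|Δ^ηA|` of (10) and the Hölder member of (9) are NOT typed here (not needed for (2)).

UNITS (checked against print).  At scale `n` the tree takes `ξ = η_n = L^{−n}` and fine spacing `1`: `U^u(b) = e^{iξA(b)}` with `‖A‖ < t` is print's `|A| < t·(L^jη)⁻¹`;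
`‖∇^ξ_μA_ν‖ = ‖ξ⁻¹(A_ν(x+e_μ) − A_ν(x))‖ < t` is print's `|∇^ηA| < t·(L^jη)⁻²`; `‖∂^{ξ*}∂^ξA‖ < t` below (two `ξ⁻¹`-normalised differences) is print's `|∂^{η*}∂^ηA| <
t·(L^jη)⁻³`; and the (1.9) threshold `t·ξ³ = t·η_n³` of `Sect2.CoDivSmallOn` is print's `t·L^{−2j}(L^jη)⁻¹` (def-P11 `Node00.Record12BgRowCoDiv` header).

CONTENTS.  §1 `Sect2.curlA ξ A y ν μ` (def; the field strength `(∂^ξA)(p_{νμ}(y)) = ∇^ξ_νA_μ(y) − ∇^ξ_μA_ν(y)`, B9 (3.4) at `U₀ ≡ 1`), `Sect2.codiffCurlA ξ A x μ` (def; print's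
`(∂^{ξ*}∂^ξA)(x, x+e_μ) = Σ_ν ξ⁻¹[(∂^ξA)(p_{νμ}(x−e_ν)) − (∂^ξA)(p_{νμ}(x))]`, [6] (1.2) at `U₀ ≡ 1`, sign as in `Sect2.coDivTerm`), `curlA_self`, `curlA_swap`;
`Sect2.plaqExponents ξ A y α β` (def; the four oriented exponents `[iξA_α(y), iξA_β(y+e_α), −iξA_α(y+e_β), −iξA_β(y)]` of `∂(e^{iξA})(p_{αβ}(y))`, B9 (3.1)∕(3.5)),
`length_plaqExponents`, ★ `sum_plaqExponents` (`Σ = iξ·ξ·(∂^ξA)(p)` — B9 (3.4)∕(3.6) «`Σ_j b_j = iη²(D^ηA)(p)`»), `norm_le_of_mem_plaqExponents` (letters `≤ ξt` from `|A| < t`),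
`norm_exponent_shift_sub_le` + `forall₂_plaqExponents` (exponents of the plaquettes at `x−e_ν` and `x` differ by `≤ ξ·ξt` from `|∇^ξA| < t`), `norm_sum_plaqExponents_le`
(`‖Σ‖ ≤ 2ξ²t`), `ιSU_gaugeAct` (`ι(U^u(b))` is r11's `gaugeU` letter), ★ `plaqMat_gaugeAct_eq_holonomy` (under the gauge equation on the four bonds,
`(∂U^u)(p) = holonomy (plaqExponents …)` in `M_N(ℂ)`).  §2 `Sect2.bondsDeep Y` (def), `bondsDeep_mono`, `bondsDeep_subset_bonds`; ★★ `Sect2.LocalGauge10On Y ξ t U` (def),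
`.toLocalGaugeOn`, `.of_le`, `.anti`; `localGauge10On_one` (NON-VACUITY: the flat configuration with `u ≡ 1`, `A ≡ 0` on every `Y`, every `ξ`, every `t > 0`).

HONEST FRAMING: definitions with bodies + bookkeeping identities about the tree's own objects; NOTHING of Bałaban's analysis asserted or proved; no named `Prop` fact;
K0⁷ ∕ V15 stub 1 NOT closed; N07 NOT discharged; counts unmoved (5∕27); one finite T⁴ programme at fixed ε — NOT continuum ∕ ℝ⁴ ∕ OS ∕ mass gap ∕ Clay.  Five `def`s,
no `instance`, no `notation`, no `sorry`.
-/

noncomputable section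

open scoped Matrix.Norms.L2Operator

namespace Literature.MathematicalPhysics.QuantumFieldTheory.Balaban1983to89.Node00

open Complex (I)
open NormedSpace
open Beta.TransportVertices (holonomy holonomy_cons holonomy_nil)
open B15DeterminingSets
open B12RegularSpaces111 (gaugeU expI grad)

/-! ## §1  The letters: `∂^ξA`, `∂^{ξ*}∂^ξA`, the four exponents of a plaquette of `e^{iξA}` -/

section Letters

variable {P : Params} {N : ℕ} [NeZero N]

/-- **The field strength of a potential at the trivial background**: `(∂^ξA)(p_{νμ}(y)) = ∇^ξ_νA_μ(y) − ∇^ξ_μA_ν(y)` (r11's `grad`: `∇^ξ_νF(y) = ξ⁻¹(F(y+e_ν) − F(y))`) —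
B9 (3.4) «(D^η_{U₀}A)(p_{μν}(x)) = (D^η_{U₀,μ}A_ν)(x) − (D^η_{U₀,ν}A_μ)(x)» at `U₀ ≡ 1`, in the tree's `ξ⁻¹`-normalisation.
[cite: Balaban1985BackgroundPropagators, (3.4) p.391; Balaban1985RegularSpaces, (1.2) p.76] -/
def Sect2.curlA {j : ℕ} (ξ : ℝ) (A : PBond P j → MatA N) (y : Site P j) (ν μ : Fin P.d) : MatA N :=
  grad ξ ν (fun z => A ⟨z, μ⟩) y - grad ξ μ (fun z => A ⟨z, ν⟩) y

/-- **PRINT'S SECOND-ORDER LETTER `(∂^{ξ*}∂^ξA)(x, x+e_μ)`** ([15] Thm 1 (10) «|∂^{η*}∂^ηA| < B₃Mε₁(L^jη)⁻³», [6] (1.140) «(L^jη)³|D*_{U₀}D_{U₀}A| < α₂») at the trivial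
background: the co-differential ([6] (1.2), `(D^{η*}_UF)_μ(x) = Σ_{ν<μ}(D^{η*}_{U,ν}F_{νμ})(x) − Σ_{ν>μ}(D^{η*}_{U,ν}F_{μν})(x)`, `(D^{η*}_νG)(x) = η⁻¹(G(x−e_ν) − G(x))` at
`U ≡ 1`) of the field strength `∂^ξA`: `Σ_ν ξ⁻¹[(∂^ξA)(p_{νμ}(x−e_ν)) − (∂^ξA)(p_{νμ}(x))]` (`F_{μν} = −F_{νμ}` folds the two sums; the `ν = μ` term vanishes) — the
linear part of `η·(D^{η*}_U∂U)(x, x+e_μ)` (`Sect2.coDivSum`) for `U = e^{iξA}`, same orientation and sign. [cite: Balaban1985Variational, Thm 1 (10) p.279; Balaban1985RegularSpaces, (1.2) p.76, (1.140) p.100] -/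
def Sect2.codiffCurlA {j : ℕ} (ξ : ℝ) (A : PBond P j → MatA N) (x : Site P j) (μ : Fin P.d) : MatA N :=
  ∑ ν : Fin P.d, (ξ : ℂ)⁻¹ • (Sect2.curlA ξ A (x.unshift ν) ν μ - Sect2.curlA ξ A x ν μ)

/-- **The four oriented exponents of the plaquette variable of `e^{iξA}`** at `p_{αβ}(y) = ⟨y, y+e_α, y+e_α+e_β, y+e_β⟩`: `[iξA_α(y), iξA_β(y+e_α), −iξA_α(y+e_β), −iξA_β(y)]`,
so that `∂(e^{iξA})(p) = holonomy` of this list (B9 (3.1) with (3.5) «U(x, x′) = U⁻¹(x′, x), A(x, x′) = −A(x′, x)»; cf. pub-balaban's `B12Eq439WilsonHessian.plaqLetters` on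
an abstract lattice). [cite: Balaban1985BackgroundPropagators, (3.1) p.390, (3.5)–(3.6) p.391] -/
def Sect2.plaqExponents {j : ℕ} (ξ : ℝ) (A : PBond P j → MatA N) (y : Site P j) (α β : Fin P.d) : List (MatA N) :=
  [((I * ξ) • A ⟨y, α⟩ : MatA N), (I * ξ) • A ⟨y.shift α, β⟩, -((I * ξ) • A ⟨y.shift β, α⟩), -((I * ξ) • A ⟨y, β⟩)]

omit [NeZero N] in
/-- `(∂^ξA)(p_{μμ}) = 0` (the diagonal term of the co-differential vanishes). [cite: Balaban1985BackgroundPropagators, (3.4) p.391 (bookkeeping)] -/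
theorem Sect2.curlA_self {j : ℕ} (ξ : ℝ) (A : PBond P j → MatA N) (y : Site P j) (μ : Fin P.d) : Sect2.curlA ξ A y μ μ = 0 :=
  sub_self _

omit [NeZero N] in
/-- Antisymmetry `(∂^ξA)(p_{μν}) = −(∂^ξA)(p_{νμ})` ([6] (1.2) «F_{μν} = −F_{νμ}» folding the two sums of the co-differential). [cite: Balaban1985RegularSpaces, (1.2) p.76 (bookkeeping)] -/
theorem Sect2.curlA_swap {j : ℕ} (ξ : ℝ) (A : PBond P j → MatA N) (y : Site P j) (ν μ : Fin P.d) :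
    Sect2.curlA ξ A y μ ν = -Sect2.curlA ξ A y ν μ :=
  (neg_sub _ _).symm

omit [NeZero N] in
/-- `(x − e_μ) + e_μ = x` on the torus (elementary). [folklore] -/
private theorem shift_unshift {j : ℕ} (x : Site P j) (μ : Fin P.d) : (x.unshift μ).shift μ = x := by
  funext ν
  by_cases h : ν = μ
  · subst h; simp [Site.shift, Site.unshift]
  · simp [Site.shift, Site.unshift, Function.update_of_ne h]

omit [NeZero N] in
/-- The list has four exponents. [cite: Balaban1985BackgroundPropagators, (3.1) p.390 (bookkeeping)] -/
theorem Sect2.length_plaqExponents {j : ℕ} (ξ : ℝ) (A : PBond P j → MatA N) (y : Site P j) (α β : Fin P.d) :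
    (Sect2.plaqExponents ξ A y α β).length = 4 := rfl

omit [NeZero N] in
/-- ★ **The exponent sum of a plaquette is `iξ·ξ·(∂^ξA)(p)`** — B9 (3.4)∕(3.6) «`A(x,y) + R(U₀(x,y))A(y,z) + R(U₀(x,w))A(z,w) + A(w,x) = η(D^η_{U₀}A)(p)`» at `U₀ ≡ 1`
(`ξ ≠ 0`). [cite: Balaban1985BackgroundPropagators, (3.4) p.391, (3.6) p.391] -/
theorem Sect2.sum_plaqExponents {j : ℕ} {ξ : ℝ} (hξ : ξ ≠ 0) (A : PBond P j → MatA N) (y : Site P j) (α β : Fin P.d) :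
    (Sect2.plaqExponents ξ A y α β).sum = (I * ξ) • ((ξ : ℂ) • Sect2.curlA ξ A y α β) := by
  have hξ' : (ξ : ℂ) ≠ 0 := Complex.ofReal_ne_zero.mpr hξ
  simp only [Sect2.plaqExponents, Sect2.curlA, grad, List.sum_cons, List.sum_nil, add_zero, smul_sub, smul_smul,
    mul_inv_cancel₀ hξ', one_smul]
  abel

omit [NeZero N] in
/-- **The exponents are small**: if `‖A(b)‖ < t` on the bonds of `Y` and the four corners of `p_{αβ}(y)` lie in `Y`, every exponent has norm `≤ ξ·t` (`0 ≤ ξ`).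
[cite: Balaban1985Variational, Thm 1 (9) p.279; Balaban1987RG1, (1.12) p.262 (bookkeeping)] -/
theorem Sect2.norm_le_of_mem_plaqExponents {Y : Set (Site P 0)} {ξ t : ℝ} (hξ : 0 ≤ ξ) {A : PBond P 0 → MatA N}
    (hA : ∀ b ∈ (Sect2.regionOfSet P Y).bonds, ‖A b‖ < t) {y : Site P 0} {α β : Fin P.d}
    (h1 : y ∈ Y) (h2 : y.shift α ∈ Y) (h3 : y.shift β ∈ Y) (h4 : (y.shift α).shift β ∈ Y) :
    ∀ b ∈ Sect2.plaqExponents ξ A y α β, ‖b‖ ≤ ξ * t := by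
  have h4' : (y.shift β).shift α ∈ Y := by rw [← Site.shift_comm]; exact h4
  intro b hb
  simp only [Sect2.plaqExponents, List.mem_cons, List.not_mem_nil, or_false] at hb
  rcases hb with rfl | rfl | rfl | rfl
  · rw [B12Membership314.norm_I_mul_smul hξ]; exact mul_le_mul_of_nonneg_left (hA ⟨y, α⟩ ⟨h1, h2⟩).le hξ
  · rw [B12Membership314.norm_I_mul_smul hξ]; exact mul_le_mul_of_nonneg_left (hA ⟨y.shift α, β⟩ ⟨h2, h4⟩).le hξ
  · rw [norm_neg, B12Membership314.norm_I_mul_smul hξ]; exact mul_le_mul_of_nonneg_left (hA ⟨y.shift β, α⟩ ⟨h3, h4'⟩).le hξ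
  · rw [norm_neg, B12Membership314.norm_I_mul_smul hξ]; exact mul_le_mul_of_nonneg_left (hA ⟨y, β⟩ ⟨h1, h3⟩).le hξ

omit [NeZero N] in
/-- **One shifted exponent**: `‖iξA_κ(y+e_ν) − iξA_κ(y)‖ ≤ ξ·(ξt)` from the stencil bound `‖∇^ξ_νA_κ(y)‖ < t` at `(y, ν, κ)` (`0 < ξ`). [cite: Balaban1985Variational, Thm 1 (9) p.279 (bookkeeping)] -/
theorem Sect2.norm_exponent_shift_sub_le {Y : Set (Site P 0)} {ξ t : ℝ} (hξ : 0 < ξ) {A : PBond P 0 → MatA N}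
    (hdA : ∀ q ∈ (Sect2.regionOfSet P Y).dpairs, ‖grad ξ q.2.1 (fun y => A ⟨y, q.2.2⟩) q.1‖ < t)
    {y : Site P 0} {ν κ : Fin P.d} (hq : (y, ν, κ) ∈ (Sect2.regionOfSet P Y).dpairs) :
    ‖(I * ξ) • A ⟨y.shift ν, κ⟩ - (I * ξ) • A ⟨y, κ⟩‖ ≤ ξ * (ξ * t) := by
  have hξ' : (ξ : ℂ) ≠ 0 := Complex.ofReal_ne_zero.mpr hξ.ne'
  have hg := (hdA _ hq).le
  have hdiff : A ⟨y.shift ν, κ⟩ - A ⟨y, κ⟩ = (ξ : ℂ) • grad ξ ν (fun z => A ⟨z, κ⟩) y := by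
    rw [grad, smul_inv_smul₀ hξ']
  rw [← smul_sub, B12Membership314.norm_I_mul_smul hξ.le, hdiff, norm_smul, Complex.norm_real, Real.norm_of_nonneg hξ.le]
  exact mul_le_mul_of_nonneg_left (mul_le_mul_of_nonneg_left hg hξ.le) hξ.le

omit [NeZero N] in
/-- **The exponents of the plaquette at `x′` and of its translate at `x′+e_ν` differ termwise by `≤ ξ·(ξt)`**, from the four stencil bounds `‖∇^ξ_νA‖ < t` at
`(x′, ν, α)`, `(x′+e_α, ν, β)`, `(x′+e_β, ν, α)`, `(x′, ν, β)` — the difference quotient `(D^{η*}_ν F)(x) = η⁻¹(F(x−e_ν) − F(x))` of [6] (1.1) read on the exponents.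
[cite: Balaban1985RegularSpaces, (1.1)–(1.2) p.76; Balaban1985Variational, Thm 1 (9) p.279 (bookkeeping)] -/
theorem Sect2.forall₂_plaqExponents {Y : Set (Site P 0)} {ξ t : ℝ} (hξ : 0 < ξ) {A : PBond P 0 → MatA N}
    (hdA : ∀ q ∈ (Sect2.regionOfSet P Y).dpairs, ‖grad ξ q.2.1 (fun y => A ⟨y, q.2.2⟩) q.1‖ < t)
    {x' : Site P 0} {ν α β : Fin P.d}
    (q1 : (x', ν, α) ∈ (Sect2.regionOfSet P Y).dpairs) (q2 : (x'.shift α, ν, β) ∈ (Sect2.regionOfSet P Y).dpairs)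
    (q3 : (x'.shift β, ν, α) ∈ (Sect2.regionOfSet P Y).dpairs) (q4 : (x', ν, β) ∈ (Sect2.regionOfSet P Y).dpairs) :
    List.Forall₂ (fun b b' => ‖b' - b‖ ≤ ξ * (ξ * t)) (Sect2.plaqExponents ξ A (x'.shift ν) α β) (Sect2.plaqExponents ξ A x' α β) := by
  simp only [Sect2.plaqExponents]
  refine List.Forall₂.cons ?_ (List.Forall₂.cons ?_ (List.Forall₂.cons ?_ (List.Forall₂.cons ?_ List.Forall₂.nil)))
  · rw [norm_sub_rev]; exact Sect2.norm_exponent_shift_sub_le hξ hdA q1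
  · rw [norm_sub_rev, Site.shift_comm x' ν α]; exact Sect2.norm_exponent_shift_sub_le hξ hdA q2
  · rw [neg_sub_neg, Site.shift_comm x' ν β]; exact Sect2.norm_exponent_shift_sub_le hξ hdA q3
  · rw [neg_sub_neg]; exact Sect2.norm_exponent_shift_sub_le hξ hdA q4

omit [NeZero N] in
/-- **The exponent sum is `O(ξ²t)`**: `‖Σ plaqExponents‖ ≤ 2ξ²t` from the two stencil bounds at `(y, α, β)`, `(y, β, α)` (`‖(∂^ξA)(p)‖ < 2t`) — the reason the transport
error in [6] (1.54) is `O(ξ³t²)` and not `O(ξ²t²)`. [cite: Balaban1985BackgroundPropagators, (3.4)–(3.6) p.391; Balaban1985RegularSpaces, (1.54) p.85 (bookkeeping)] -/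
theorem Sect2.norm_sum_plaqExponents_le {Y : Set (Site P 0)} {ξ t : ℝ} (hξ : 0 < ξ) {A : PBond P 0 → MatA N}
    (hdA : ∀ q ∈ (Sect2.regionOfSet P Y).dpairs, ‖grad ξ q.2.1 (fun y => A ⟨y, q.2.2⟩) q.1‖ < t)
    {y : Site P 0} {α β : Fin P.d} (q1 : (y, α, β) ∈ (Sect2.regionOfSet P Y).dpairs) (q2 : (y, β, α) ∈ (Sect2.regionOfSet P Y).dpairs) :
    ‖(Sect2.plaqExponents ξ A y α β).sum‖ ≤ 2 * ξ ^ 2 * t := by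
  rw [Sect2.sum_plaqExponents hξ.ne', B12Membership314.norm_I_mul_smul hξ.le, norm_smul, Complex.norm_real, Real.norm_of_nonneg hξ.le]
  have hc : ‖Sect2.curlA ξ A y α β‖ ≤ t + t := (norm_sub_le _ _).trans (add_le_add (hdA _ q1).le (hdA _ q2).le)
  nlinarith [hξ]

/-- The embedded gauge-transformed bond variable `ι(U^u(b)) = ι(u(b₋))·ι(U(b))·ι(u(b₊))⁻¹` IS r11's letter `gaugeU (ι∘u) (ι∘U) b` of `Sect2.LocalGaugeOn`.
[cite: Balaban1987RG1, (1.10) p.262; Balaban1985Averaging, (8) p.19 (bookkeeping)] -/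
theorem ιSU_gaugeAct (u : GaugeTransf P 0 (SU N)) (U : GaugeField P 0 (SU N)) (b : PBond P 0) :
    ιSU N (GaugeField.gaugeAct u U b) = gaugeU (fun x => ιSU N (u x)) (fun b' => ιSU N (U b')) b := by
  simp only [GaugeField.gaugeAct, gaugeU, map_mul, map_inv]

/-- ★ **Under the gauge equation `(ι∘U)^{ι∘u}(b) = e^{iξA(b)}` on the four bonds of `p_{αβ}(y) ⊂ Y`, the embedded plaquette variable of `U^u` is the ordered
exponential product of the four exponents**: `Sect2.plaqMat (U^u) y α β = holonomy (plaqExponents ξ A y α β)` (module 31's `ιSU_plaqHol_gaugeAct_SU` + B9 (3.1)∕(3.5)).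
[cite: Balaban1985BackgroundPropagators, (3.1) p.390, (3.5) p.391; Balaban1987RG1, (1.12) p.262] -/
theorem Sect2.plaqMat_gaugeAct_eq_holonomy {Y : Set (Site P 0)} {ξ : ℝ} {u : GaugeTransf P 0 (SU N)} {U : GaugeField P 0 (SU N)}
    {A : PBond P 0 → MatA N}
    (he : ∀ b ∈ (Sect2.regionOfSet P Y).bonds, gaugeU (fun x => ιSU N (u x)) (fun b' => ιSU N (U b')) b = expI ξ (A b))
    {y : Site P 0} {α β : Fin P.d} (h : α < β) (h1 : y ∈ Y) (h2 : y.shift α ∈ Y) (h3 : y.shift β ∈ Y) (h4 : (y.shift α).shift β ∈ Y) :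
    Sect2.plaqMat (GaugeField.gaugeAct u U) y α β h = holonomy (Sect2.plaqExponents ξ A y α β) := by
  have h4' : (y.shift β).shift α ∈ Y := by rw [← Site.shift_comm]; exact h4
  unfold Sect2.plaqMat
  rw [ιSU_plaqHol_gaugeAct_SU]
  dsimp only
  rw [he ⟨y, α⟩ ⟨h1, h2⟩, he ⟨y.shift α, β⟩ ⟨h2, h4⟩, he ⟨y.shift β, α⟩ ⟨h3, h4'⟩, he ⟨y, β⟩ ⟨h1, h3⟩]
  simp only [Sect2.plaqExponents, Units.val_mul, holonomy_cons, holonomy_nil, mul_one, mul_assoc]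
  rfl

end Letters

/-! ## §2  The deep bonds of a site set and the clause `Sect2.LocalGauge10On` ((9) line 1 + the (10)-letter `∂^{ξ*}∂^ξA`) -/

section Clause

variable {P : Params} {N : ℕ} [NeZero N]

/-- **The deep bonds of a site set `Y`**: bonds `⟨x, x+e_μ⟩` whose two endpoints AND all their nearest neighbours `x ± e_ν`, `x+e_μ ± e_ν` lie in `Y` — exactly where the
letter `(∂^{ξ*}∂^ξA)(x, x+e_μ)` and the co-divergence `(D^{η*}_U∂U)(x, x+e_μ)` read only plaquettes ∕ bonds inside `Y` ([6] p. 77: «Ω also denotes the set of bonds with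
at least one end-point in Ω» — here the opposite, interior, convention for a cube on which a gauge is GIVEN). [cite: Balaban1985RegularSpaces, (1.2) p.76, (1.9) p.77 (bookkeeping)] -/
def Sect2.bondsDeep (Y : Set (Site P 0)) : Set (PBond P 0) :=
  {b | b.src ∈ Y ∧ b.tgt ∈ Y ∧ ∀ ν : Fin P.d, b.src.shift ν ∈ Y ∧ b.src.unshift ν ∈ Y ∧ b.tgt.shift ν ∈ Y ∧ b.tgt.unshift ν ∈ Y}

omit [NeZero N] in
/-- The deep bonds are monotone in the site set. [cite: Balaban1985RegularSpaces, (1.9) p.77 (bookkeeping)] -/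
theorem Sect2.bondsDeep_mono {Y Y' : Set (Site P 0)} (h : Y' ⊆ Y) : Sect2.bondsDeep (P := P) Y' ⊆ Sect2.bondsDeep Y :=
  fun _ hb => ⟨h hb.1, h hb.2.1, fun ν => ⟨h (hb.2.2 ν).1, h (hb.2.2 ν).2.1, h (hb.2.2 ν).2.2.1, h (hb.2.2 ν).2.2.2⟩⟩

omit [NeZero N] in
/-- Deep bonds are bonds of the region of `Y` (both endpoints in `Y`). [cite: Balaban1987RG1, (1.13) p.262 (bookkeeping)] -/
theorem Sect2.bondsDeep_subset_bonds (Y : Set (Site P 0)) : Sect2.bondsDeep (P := P) Y ⊆ (Sect2.regionOfSet P Y).bonds :=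
  fun _ hb => ⟨hb.1, hb.2.1⟩

/-- ★★ **THE LOCAL-GAUGE CLAUSE WITH PRINT'S SECOND-ORDER LETTER**: `Sect2.LocalGauge10On Y ξ t U` := there are an `SU(N)`-valued gauge transformation `u` and a potential
`A : bonds → M_N(ℂ)` with `(ι∘U)^{ι∘u}(b) = e^{iξA(b)}` and `‖A(b)‖ < t` on the bonds of `Y`, `‖∇^ξ_μA_ν(x)‖ < t` on the derivative stencils of `Y` — def-P11's
`Sect2.LocalGaugeOn Y ξ t U` ([15] Thm 1 (9) line 1 ∕ [I] (1.12) in ∃-form) — AND `‖(∂^{ξ*}∂^ξA)(b)‖ < t` on the deep bonds of `Y` ([15] Thm 1 (10), first member; [6] (1.140),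
third member, at `U₀ ≡ 1`).  One threshold `t` for the three letters as in print's (167) («|A|, |∇^ηA|, |∂^{η*}∂^ηA|, |Δ^ηA| < ε′…»); NO Laplacian member, NO Hölder member.
[cite: Balaban1985Variational, Thm 1 (9)–(10) p.279, (167) p.304; Balaban1985RegularSpaces, (1.140) p.100; Balaban1987RG1, (1.12) p.262] -/
def Sect2.LocalGauge10On (Y : Set (Site P 0)) (ξ t : ℝ) (U : GaugeField P 0 (SU N)) : Prop :=
  ∃ u : GaugeTransf P 0 (SU N), ∃ A : PBond P 0 → MatA N,
    (∀ b ∈ (Sect2.regionOfSet P Y).bonds, gaugeU (fun x => ιSU N (u x)) (fun b' => ιSU N (U b')) b = expI ξ (A b)) ∧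
    (∀ b ∈ (Sect2.regionOfSet P Y).bonds, ‖A b‖ < t) ∧
    (∀ q ∈ (Sect2.regionOfSet P Y).dpairs, ‖grad ξ q.2.1 (fun y => A ⟨y, q.2.2⟩) q.1‖ < t) ∧
    ∀ b ∈ Sect2.bondsDeep Y, ‖Sect2.codiffCurlA ξ A b.src b.dir‖ < t

omit [NeZero N] in
/-- Forgetting the second-order letter gives def-P11's clause `Sect2.LocalGaugeOn Y ξ t U` (same `u`, same `A`). [cite: Balaban1985Variational, Thm 1 (9) p.279 (bookkeeping)] -/
theorem Sect2.LocalGauge10On.toLocalGaugeOn {Y : Set (Site P 0)} {ξ t : ℝ} {U : GaugeField P 0 (SU N)}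
    (h : Sect2.LocalGauge10On Y ξ t U) : Sect2.LocalGaugeOn Y ξ t U := by
  obtain ⟨u, A, he, hA, hdA, _⟩ := h
  exact ⟨u, A, he, hA, hdA⟩

omit [NeZero N] in
/-- Monotone in the threshold. [cite: Balaban1985Variational, Thm 1 (9)–(10) p.279 (bookkeeping)] -/
theorem Sect2.LocalGauge10On.of_le {Y : Set (Site P 0)} {ξ t t' : ℝ} {U : GaugeField P 0 (SU N)}
    (h : Sect2.LocalGauge10On Y ξ t U) (ht : t ≤ t') : Sect2.LocalGauge10On Y ξ t' U := by
  obtain ⟨u, A, he, hA, hdA, h10⟩ := h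
  exact ⟨u, A, he, fun b hb => (hA b hb).trans_le ht, fun q hq => (hdA q hq).trans_le ht, fun b hb => (h10 b hb).trans_le ht⟩

omit [NeZero N] in
/-- Restriction: the clause on `Y` gives the clause on every `Y′ ⊆ Y` (same `u`, same `A`). [cite: Balaban1987RG1, (1.12) p.262 (bookkeeping)] -/
theorem Sect2.LocalGauge10On.anti {Y Y' : Set (Site P 0)} {ξ t : ℝ} {U : GaugeField P 0 (SU N)}
    (h : Sect2.LocalGauge10On Y ξ t U) (hY : Y' ⊆ Y) : Sect2.LocalGauge10On Y' ξ t U := by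
  obtain ⟨u, A, he, hA, hdA, h10⟩ := h
  exact ⟨u, A, fun b hb => he b ⟨hY hb.1, hY hb.2⟩, fun b hb => hA b ⟨hY hb.1, hY hb.2⟩,
    fun q hq => hdA q ⟨hY hq.1, hY hq.2.1, hY hq.2.2.1, hY hq.2.2.2⟩, fun b hb => h10 b (Sect2.bondsDeep_mono hY hb)⟩

/-- **NON-VACUITY (A6)**: the flat configuration `U ≡ 1` satisfies the clause on every site set, at every unit `ξ` and every threshold `t > 0`, with the trivial gauge
`u ≡ 1` and the zero potential `A ≡ 0` (all three letters vanish).  The binder block of the estimate `coDivSmallOn_of_localGauge10On` is therefore inhabited.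
[cite: Balaban1985Variational, Thm 1 (9)–(10) p.279 (degenerate instance; bookkeeping)] -/
theorem Sect2.localGauge10On_one (Y : Set (Site P 0)) (ξ : ℝ) {t : ℝ} (ht : 0 < t) :
    Sect2.LocalGauge10On Y ξ t (1 : GaugeField P 0 (SU N)) := by
  refine ⟨fun _ => 1, fun _ => 0, fun b _ => ?_, fun b _ => by simpa using ht, fun q _ => ?_, fun b _ => ?_⟩
  · rw [B12RegularSpaces111Mono.expI_zero]
    show ιSU N 1 * ιSU N 1 * (ιSU N 1)⁻¹ = 1
    simp
  · simpa [grad] using ht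
  · simpa [Sect2.codiffCurlA, Sect2.curlA, grad] using ht

end Clause

end Literature.MathematicalPhysics.QuantumFieldTheory.Balaban1983to89.Node00

end
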